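import Literature.NumberTheory.Automorphic.UnitaryThreeAnisotropicStabilizerCoordinates   -- ★ FILE 1 (this seat): coordinates, `2 × 2` model, two congruences
import HarnessLib

/-!
# The coset criterion on the anisotropic stabiliser: `h⁻¹h′ ∈ H′_m ⟺ |s q′ − q s′| ≤ |ϖ^m| ∧ |s A′ − 4ϖ q r′ − det M_h| ≤ |ϖ^{2m+1}|`
# (Flicker 1998, Prop. 16 p. 96 — LAYER B′ step 2, FILE 2a)

Topic `NumberTheory/Automorphic`; namespace `Literature.NumberTheory.Automorphic.UnitaryGroup`.  THEOREMS ONLY (no `def`, no instance, no notation, no named fact, no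
`sorry`; count-neutral).  Cell `pub/hodgecm-mathlib`, F0∕P3a road «D-N7-inert», line «N7nsCount» ((F11-c) `stub_irredGValuePos∕Neg`), B-p14 (g30) DESIGN v2 §Plan 1,
«coset criterion».  HONEST LABEL: HC_CM is proved only modulo the printed citations until rung 0 closes; coordinates here, no count yet.

THE MATHEMATICS.  For `h, k ∈ Stab(w₀)` with `h·k = h′`, the models multiply: `M_h M_k = M_{h′}` (★ `stabilizerModel_mul`), so by Cramer `D·q_k = s q′ − q s′` and
`D·A_k = s A′ − 4ϖ q r′` with `D = det M_h = A s − 4ϖ q r`, `|D| = 1` (★ `v_det_stabilizerModel`).  Hence the two congruences cutting out `H′_m` (★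
`flickerDiag_conj_mem_unitaryInt_iff_two_congruences`) read on `k = h⁻¹h′`: **`d_m⁻¹ k d_m ∈ K₀ ⟺ |s q′ − q s′| ≤ |ϖ^m| ∧ |s A′ − 4ϖ q r′ − D| ≤ |ϖ^{2m+1}|`**
(**`conj_mem_unitaryInt_iff_of_mul_eq`**) — the relation «`h H′_m = h′ H′_m`» in the `(A, q, r, s)` coordinates, over which Prop. 16's cosets are counted.

## References
* [Flicker1998UnitaryFL] Y. Z. Flicker, *Elementary proof of the fundamental lemma for a unitary group*, Canad. J. Math. 50 (1998), Prop. 4 p. 82, Prop. 16 p. 96.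
-/

set_option autoImplicit false

noncomputable section

open scoped MatrixGroups WithZero
open Matrix

namespace Literature.NumberTheory.Automorphic

namespace UnitaryGroup

open Literature.NumberTheory.Automorphic.HermitianLattice

variable {K : Type*} [Field K] [Valued K ℤᵐ⁰] {ϖ : K}
  (σ : K →+* K) {J : Matrix (Fin 3) (Fin 3) K} (hJ : J = (StdForm.antidiagonal 3).over K)

omit [Valued K ℤᵐ⁰] in
/-- **CRAMER ON `M_h M_k = M_{h′}`**: `D·q_k = s q′ − q s′` and `D·A_k = s A′ − 4ϖ q r′`, `D = det M_h = A s − 4ϖ q r`. [cite: Flicker1998UnitaryFL, Prop. 16 p. 96] -/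
theorem det_mul_coords_of_mul_eq {h k h' : ↥(unitaryGroupOfForm σ J)} {b q r s bk qk rk sk b' q' r' s' : K}
    (hh : ((h : GL (Fin 3) K) : Matrix (Fin 3) (Fin 3) K) = !![1 + 2 * ϖ * b, q, b; 2 * ϖ * r, s, r; 4 * ϖ ^ 2 * b, 2 * ϖ * q, 1 + 2 * ϖ * b])
    (hk : ((k : GL (Fin 3) K) : Matrix (Fin 3) (Fin 3) K) = !![1 + 2 * ϖ * bk, qk, bk; 2 * ϖ * rk, sk, rk; 4 * ϖ ^ 2 * bk, 2 * ϖ * qk, 1 + 2 * ϖ * bk])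
    (hh' : ((h' : GL (Fin 3) K) : Matrix (Fin 3) (Fin 3) K) = !![1 + 2 * ϖ * b', q', b'; 2 * ϖ * r', s', r'; 4 * ϖ ^ 2 * b', 2 * ϖ * q', 1 + 2 * ϖ * b'])
    (hhk : h * k = h') :
    ((1 + 4 * ϖ * b) * s - 4 * ϖ * q * r) * qk = s * q' - q * s' ∧
      ((1 + 4 * ϖ * b) * s - 4 * ϖ * q * r) * (1 + 4 * ϖ * bk) = s * (1 + 4 * ϖ * b') - 4 * ϖ * q * r' := by
  have hM := stabilizerModel_mul σ (J := J) hh hk (by rw [hhk]; exact hh')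
  have e00 := congrFun (congrFun hM 0) 0
  have e01 := congrFun (congrFun hM 0) 1
  have e10 := congrFun (congrFun hM 1) 0
  have e11 := congrFun (congrFun hM 1) 1
  simp [Matrix.mul_apply, Fin.sum_univ_two] at e00 e01 e10 e11
  constructor
  · linear_combination (-s) * e01 + q * e11
  · linear_combination (-s) * e00 + q * e10

include hJ in
/-- **THE COSET CRITERION** (`h H′_m = h′ H′_m` in coordinates): for `h, h′ ∈ Stab(w₀)` and `k = h⁻¹h′` (given with its coordinates, `h·k = h′`),
`d_m⁻¹ k d_m ∈ K₀ ⟺ |s q′ − q s′| ≤ |ϖ^m| ∧ |s A′ − 4ϖ q r′ − det M_h| ≤ |ϖ^{2m+1}|` (`|det M_h| = 1`; ★ FILE 1 two congruences for `k`).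
[cite: Flicker1998UnitaryFL, Prop. 16 p. 96] -/
theorem conj_mem_unitaryInt_iff_of_mul_eq (hd : LocalConjDatum σ ϖ) (m : ℕ) {d h k h' : ↥(unitaryGroupOfForm σ J)}
    (hdm : ((d : GL (Fin 3) K) : Matrix (Fin 3) (Fin 3) K) = !![ϖ ^ m, 0, 0; 0, 1, 0; 0, 0, (ϖ ^ m)⁻¹]) {b q r s bk qk rk sk b' q' r' s' : K}
    (hh : ((h : GL (Fin 3) K) : Matrix (Fin 3) (Fin 3) K) = !![1 + 2 * ϖ * b, q, b; 2 * ϖ * r, s, r; 4 * ϖ ^ 2 * b, 2 * ϖ * q, 1 + 2 * ϖ * b])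
    (hk : ((k : GL (Fin 3) K) : Matrix (Fin 3) (Fin 3) K) = !![1 + 2 * ϖ * bk, qk, bk; 2 * ϖ * rk, sk, rk; 4 * ϖ ^ 2 * bk, 2 * ϖ * qk, 1 + 2 * ϖ * bk])
    (hh' : ((h' : GL (Fin 3) K) : Matrix (Fin 3) (Fin 3) K) = !![1 + 2 * ϖ * b', q', b'; 2 * ϖ * r', s', r'; 4 * ϖ ^ 2 * b', 2 * ϖ * q', 1 + 2 * ϖ * b'])
    (hhk : h * k = h') :
    d⁻¹ * k * d ∈ unitaryInt σ J ↔
      Valued.v (s * q' - q * s') ≤ Valued.v (ϖ ^ m) ∧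
        Valued.v (s * (1 + 4 * ϖ * b') - 4 * ϖ * q * r' - ((1 + 4 * ϖ * b) * s - 4 * ϖ * q * r)) ≤ Valued.v (ϖ ^ (2 * m + 1)) := by
  obtain ⟨hq, hA⟩ := det_mul_coords_of_mul_eq σ (J := J) hh hk hh' hhk
  have hD : Valued.v ((1 + 4 * ϖ * b) * s - 4 * ϖ * q * r) = 1 := by
    have h := v_det_stabilizerModel σ hJ hd hh
    rw [Matrix.det_fin_two_of] at h
    rwa [show (1 + 4 * ϖ * b) * s - 4 * ϖ * q * r = (1 + 4 * ϖ * b) * s - q * (4 * ϖ * r) by ring]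
  have e1 : s * q' - q * s' = ((1 + 4 * ϖ * b) * s - 4 * ϖ * q * r) * qk := hq.symm
  have e2 : s * (1 + 4 * ϖ * b') - 4 * ϖ * q * r' - ((1 + 4 * ϖ * b) * s - 4 * ϖ * q * r) =
      ((1 + 4 * ϖ * b) * s - 4 * ϖ * q * r) * (1 + 4 * ϖ * bk - 1) := by rw [mul_sub, mul_one, hA]
  rw [flickerDiag_conj_mem_unitaryInt_iff_two_congruences σ hJ hd m hdm hk, e1, e2, map_mul, map_mul, hD, one_mul, one_mul]

end UnitaryGroup

end Literature.NumberTheory.Automorphic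

end
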